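import Summits.QuantumFields.YangMills.Theorems.BalabanUVNodesPortS1LZdetTwinBridge

/-!
# Crux `PortRecordRepresentationS1` (stmt-QuantumFields-27930), line `pta-residueW` (skeleton v3.4) — REGISTERED STUB `stub_LZdetTwin` LANDED: `∀ F, PowMemberIntTwin F` (the integer twin of the
# (63) power member: one window-local `SL(2,ℂ)`-invariant integer formula per `(k, carriers, R)` whose pull-back pieces off the centred wrap class are the torus power pieces), by
# `…LZdetTwinBridge.powMemberIntTwin_holds`

Cell `ym-nodeO-ideate`, porter seat `ymgap-nodeO-port-PTA-1` (gen 8, lead of the line); `--supports stmt-QuantumFields-27930` (stub credit: proves the registered stub BY NAME AND SIGNATURE).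
After this file the skeleton `Cruxes/PortRecordRepresentationS1/Lines/pta_residueW.lean` (v3.4) has THREE open stubs — `stub_P0C` (`P0HolExtAtRecordGL`, P0-class letter, node00-def-Y), `stub_G3C`
(`G3CAtRecordL`, hand-27930-G3C) and `stub_FE` (`PortRecordFEHalfBox`, XXL) — and the porter's glue `stub_LZdetGlue : ∀ F, P0HolExtAtRecordGL F → G3CAtRecordL F → PortRecordLZdetHalf F` is a
THEOREM OUTRIGHT (✓`…LZdetGlue.lzdetHalf_of_twin_GL` ∘ this file): the whole `log Z^{(k)}` half of print's (2.12) at the record is in Thm 3's format MODULO the two displayed letters.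

HONEST FRAMING.  One registered stub proved — torus ∕ integer BOOKKEEPING (transport of the (63) power series along the centred lift, (Z-supp)(Z-dom)(Z-loc)(Z-cov)(Z-bridge) of the DISPLAYED P0-ℂ body);
NOTHING of Bałaban's renormalization-group estimates asserted or re-proved; the crux 27930 ⁸-Ax-LR4 is OPEN · no claim; NODE O 0∕1; COUNT 8∕28 · K 1∕4 UNMOVED; finite `𝕋⁴_{L^K}` at fixed ε — NOT
continuum ∕ OS ∕ Clay; **the Yang–Mills mass gap is NOT proved by any of this.**  No `sorry`; standard axioms.
-/

namespace Summit.QuantumFields.YangMills.Theorems.BalabanUVNodesPortS1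

/-- ★★★ **REGISTERED STUB `stub_LZdetTwin` OF THE LINE `pta-residueW`**: the integer twin of the (63) power member exists for every torus family.
[cite: Balaban1987RG1, (1.21) p.264, (1.7) p.261, (1.19) p.263; Balaban1985UV3, (63) p.272] -/
theorem stub_LZdetTwin : ∀ F, Summit.QuantumFields.YangMills.Theorems.BalabanUVNodesPortS1.PowMemberIntTwin F :=
  fun F => powMemberIntTwin_holds F

end Summit.QuantumFields.YangMills.Theorems.BalabanUVNodesPortS1
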